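import Summits.ValiantsHypothesis.ValiantsHypothesis.Theorems.LacunarySymmetroidMatrixDescartesCensusPivotKit

/-!
# `MatrixDescartes` census — rank-one `(2,4)₁`, the `1|3` split: AN ALL-CORE ONE-SIDED OBJECT WITH SEVEN POSITIVE ROOTS
# (dyadic pole weaving in the core: `det F` alternates at `x = 1/2, 7/8, 15/16, 31/32, 63/64, 127/128, 1, 2`)

HONEST FRAMING.  Object-search cell `pub-symmetroid`, seat `val-sym-mdr-p1` (generation 25); helper file `--supports` the crux item
stmt-ValiantsHypothesis-18050 (`Theses.LacunarySymmetroid.MatrixDescartes`, OPEN, on HOLD) with NO closure claim.  A DATUM (located → kernel)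
for the `m = 2` pivot column: in the HYPERBOLIC NORMAL FORM of the lineage's window-profile files (`F(x) = x^e[[0,1],[1,0]] + ∑ₖ wₖx^{dₖ}(1,tₖ)(1,tₖ)ᵀ`,
all positions `tₖ > 0` — the «all core» class —, ONE letter below the pivot exponent) the `K = 4` object
`e = 1`, `d = (0, 8, 53, 248)`, `w = (2, 19/2, 42, 212)`, `t = (1/16384, 1, 1, 1 + 2⁻²¹)` has AT LEAST SEVEN positive roots:
`det F = A C − (U + x)²` takes the signs `− + − + − + − +` at the dyadic ladder `1/2, 7/8, 15/16, 31/32, 63/64, 127/128, 1, 2`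
(**`seven_le_sevenObject_pivotPosRoots`**, `exists_oneSided_allCore_seven`).  The three upper letters all lie on ONE side of the pivot
letter's position (`1/16384 < 1 ≤ 1 + 2⁻²¹`) and two of them are parallel.
READING.  (i) This CORRECTS the lineage's located record «maximum 5 on the whole 1|3 split» (seat memos PROFILE-GAUGE §5–§6, CURVATURE; the searches
used bounded exponent boxes): the all-fast Descartes-7 chamber (`a < b₁ < b₂ < b₃`; sign word `− − + − + − + + − + +`) IS attained — the
answer to PROFILE-GAUGE §6's sharpness question.  It is consistent with «rank-one (2,4)₁ = 8» (only chamber (C) allows 9) and with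
`…CensusPivotDefs.RankOnePivotLawTwo` (`≤ 2K + 2 = 10`).  (ii) With `…CriticalWindowsSideCount.rankOne_card_posRoots_le_max_add_one` (this
session): the populated side carries AT LEAST SIX critical directions of the window profile — `2 ×` (letters beyond the pivot letter): the
per-side conjecture «≤ 2 critical directions per letter beyond the pivot» is SATURATED at `n = 3`.  (iii) MECHANISM (located, seat memo
ROOT-COUNT.md §5): the object is val-sym-mdr-p2's kernel BARE pole-weaving pencil (`…PivotStaircaseBare`, exactly `2K − 2` roots, isotropic
pivot letter, parallel upper letters) pushed INTO the core (`tₚ = 2⁻¹⁴ > 0`) with the top letter split off (`t₃ = 1 + 2⁻²¹`), which flips the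
sign of `det F` at `+∞` and adds the seventh root; located the same way: `2K − 1` for `K = 3, 4, 5`.  Nothing here bears on `MatrixDescartes`
in its window, on `DoorA26` / `DoorA34`, the rank-one register `{8, 9}`, ζ, or `VP ≠ VNP`.

[folklore] IVT certificate via `Pivot.le_pivotPosRoots_of_certificate`.  No definitions, no named facts.
-/

-- `Summit.ValiantsHypothesis.ValiantsHypothesis.…` repeats a component by the D-0017 layout
-- (single-conjunct summit), which the `dupNamespace` linter flags; the name is mandated.
set_option linter.dupNamespace false

namespace Summit.ValiantsHypothesis.ValiantsHypothesis.Theorems.LacunarySymmetroidMatrixDescartes.Pivot.CriticalWindows.OneSidedSeven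

open Polynomial Finset Matrix
open scoped BigOperators
open Summit.ValiantsHypothesis.ValiantsHypothesis.Theorems.LacunarySymmetroidMatrixDescartes.Pivot
  (pivotPosRoots le_pivotPosRoots_of_certificate)

/-- Closed form of `det F(x)` for the seven object: `det F = A C − (U + x)²` with `A = 2 + (19/2)x⁸ + 42x⁵³ + 212x²⁴⁸`,
`U = 2·2⁻¹⁴ + (19/2)x⁸ + 42x⁵³ + 212(1 + 2⁻²¹)x²⁴⁸`, `C = 2·2⁻²⁸ + (19/2)x⁸ + 42x⁵³ + 212(1 + 2⁻²¹)²x²⁴⁸`. [this file] -/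
theorem eval_det_sevenObject (x : ℝ) :
    (x ^ 1 • ((!![(0 : ℝ), 1; 1, 0] : Matrix (Fin 2) (Fin 2) ℝ))
      + ∑ k, x ^ (![0, 8, 53, 248] : Fin 4 → ℕ) k •
        ((fun k => (![(2 : ℝ), 19 / 2, 42, 212] : Fin 4 → ℝ) k
            • vecMulVec ![1, (![(1 : ℝ) / 16384, 1, 1, 1 + 1 / 2097152] : Fin 4 → ℝ) k]
              ![1, (![(1 : ℝ) / 16384, 1, 1, 1 + 1 / 2097152] : Fin 4 → ℝ) k]) k)).det
      = (2 + 19 / 2 * x ^ 8 + 42 * x ^ 53 + 212 * x ^ 248)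
          * (2 * (1 / 16384) ^ 2 + 19 / 2 * x ^ 8 + 42 * x ^ 53 + 212 * (1 + 1 / 2097152) ^ 2 * x ^ 248)
        - (2 * (1 / 16384) + 19 / 2 * x ^ 8 + 42 * x ^ 53 + 212 * (1 + 1 / 2097152) * x ^ 248 + x) ^ 2 := by
  rw [Matrix.det_fin_two]
  simp [Matrix.add_apply, Fin.sum_univ_succ, Matrix.vecHead, Matrix.vecTail]
  ring

/-- **AT LEAST SEVEN POSITIVE ROOTS**: `det F` takes the signs `− + − + − + − +` at `x = 1/2, 7/8, 15/16, 31/32, 63/64, 127/128, 1, 2`.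
[this file] -/
theorem seven_le_sevenObject_pivotPosRoots :
    7 ≤ pivotPosRoots 1 (![0, 8, 53, 248] : Fin 4 → ℕ) ((!![(0 : ℝ), 1; 1, 0] : Matrix (Fin 2) (Fin 2) ℝ))
      (fun k => (![(2 : ℝ), 19 / 2, 42, 212] : Fin 4 → ℝ) k
        • vecMulVec ![1, (![(1 : ℝ) / 16384, 1, 1, 1 + 1 / 2097152] : Fin 4 → ℝ) k]
          ![1, (![(1 : ℝ) / 16384, 1, 1, 1 + 1 / 2097152] : Fin 4 → ℝ) k]) :=
  le_pivotPosRoots_of_certificate (N := 7) eval_det_sevenObject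
    ![1 / 2, 7 / 8, 15 / 16, 31 / 32, 63 / 64, 127 / 128, 1, 2]
    (by
      refine Fin.strictMono_iff_lt_succ.2 fun j => ?_
      fin_cases j <;> simp only [Fin.castSucc_mk, Fin.succ_mk] <;> norm_num)
    (by intro j; fin_cases j <;> norm_num)
    (by intro j; fin_cases j <;> simp only [Fin.castSucc_mk, Fin.succ_mk] <;> norm_num)

/-- **EXISTENCE FORM**: an all-core (`tₖ > 0`), one-sided (`tₚ < tₖ` for the upper letters), `1|3`-split (`dₚ < e < dₖ`) rank-one pencil in
hyperbolic normal form with at least seven positive roots. [this file] -/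
theorem exists_oneSided_allCore_seven :
    ∃ (e : ℕ) (d : Fin 4 → ℕ) (w t : Fin 4 → ℝ), (∀ m, 0 < w m) ∧ (∀ m, 0 < t m) ∧ d 0 < e ∧ (∀ m, m ≠ 0 → e < d m) ∧
      (∀ m, m ≠ 0 → t 0 < t m) ∧
      7 ≤ pivotPosRoots e d ((!![(0 : ℝ), 1; 1, 0] : Matrix (Fin 2) (Fin 2) ℝ)) (fun k => w k • vecMulVec ![1, t k] ![1, t k]) :=
  ⟨1, ![0, 8, 53, 248], ![2, 19 / 2, 42, 212], ![1 / 16384, 1, 1, 1 + 1 / 2097152],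
    by intro m; fin_cases m <;> norm_num [Matrix.cons_val_two, Matrix.vecHead, Matrix.vecTail],
    by intro m; fin_cases m <;> norm_num [Matrix.cons_val_two, Matrix.vecHead, Matrix.vecTail],
    by decide,
    by intro m hm; fin_cases m <;> first | exact absurd rfl hm | decide,
    by intro m hm; fin_cases m <;> first | exact absurd rfl hm | norm_num [Matrix.cons_val_two, Matrix.vecHead, Matrix.vecTail],
    seven_le_sevenObject_pivotPosRoots⟩

end Summit.ValiantsHypothesis.ValiantsHypothesis.Theorems.LacunarySymmetroidMatrixDescartes.Pivot.CriticalWindows.OneSidedSeven
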